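import Summits.QuantumFields.YangMills.Theorems.LuscherReductionDressedRitzPolyakovLiftStaticsOfGram
import Summits.QuantumFields.YangMills.Theorems.LuscherReductionOneSiteLevelsVariational
import Summits.QuantumFields.YangMills.Theorems.LuscherReductionRunningReductionKTPhysSpace
import Summits.QuantumFields.YangMills.Theorems.LuscherReductionDressedRitzOfOperatorPlateau
import HarnessLib

/-!
# Line «polyakovlift» r7 on crux `DressedRitz` (stmt-QuantumFields-20205): S-STAT (o2) — the Gram certificate from a NEAR-ISOMETRY of the dressed lift on
# two-channel planes (polarisation); linearity of `g ↦ dressedLiftVec β φ g`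

Fleet-service module of seat ym-infvol-p1 g7.  `…PolyakovLiftStaticsOfGram` reduces the r7 statics text to a Gram certificate on the dressed lifts
`u_i = dressedLiftVec β φ g_i`.  Renormalisation-group / static-matching statements are naturally NORM statements («`‖u‖² = (1 ± ε)·N(g)`» for a flat quadratic
form `N`); this file supplies the polarisation step turning them into the certificate:

* §1 linearity plumbing on physical test functions: `OpPlat.ins_add/ins_smul`, `liftVec_add/smul`, `iterate_transferApply_add/smul`, ★ `dressedLiftVec_add/smul`,
  `isPhys_smul_add` ;  §2 `l2_self_add_smul` (expansion of `‖a u + b v‖²`);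
* §3 ★★ `gram_offDiag_le_of_nearIsometry` — if `(1−ε)(a²n_i + b²n_l) ≤ ‖dressedLiftVec β φ (a g_i + b g_l)‖² ≤ (1+ε)(a²n_i + b²n_l)` for all real `a, b`
  (near-isometry on the plane of two channels w.r.t. flat weights `n_i, n_l > 0`), then `|⟨u_i, u_l⟩| ≤ ε·√n_i·√n_l`;
  ★★ `staticClauses_of_nearIsometry` — near-isometry on every two-channel plane (symmetric pairs may instead be `PairSeparated`) + `ε/(1−ε) ≤ C·λ` ⟹
  `StaticClauses k C β (dressedLiftFamily β φ g)`.

HONEST FRAMING: bookkeeping on the conditional femto rung R2b1; the near-isometry is RG input, NOT proved here; not infinite volume, not a gap, not Clay.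
References: M. Lüscher, NPB 219 (1983) 233 [cite: Luscher1983, §3]; M. Lüscher, U. Wolff, NPB 339 (1990) 222 [cite: LuscherWolff1990].
-/

set_option autoImplicit false

noncomputable section

open MeasureTheory Filter Topology Real
open Literature.MathematicalPhysics.QuantumFieldTheory (GaugeConfig Site gaugeTransform)
open scoped BigOperators

namespace Summit.QuantumFields.YangMills.Theorems.FemtoTransferGap.PolyakovLift

open Summit.QuantumFields.YangMills.Theorems.FemtoTransferGap

variable {L : ℕ} [NeZero L]

/-! ## §1 Linearity of the (dressed) lift in the one-site function -/

/-- `a•ψ + b•φ` is physical for physical `ψ, φ`. [folklore] -/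
theorem isPhys_smul_add {M : ℕ} {ψ φ : GaugeConfig 3 M SU2 → ℝ} (hψ : IsPhys ψ) (hφ : IsPhys φ) (a b : ℝ) : IsPhys (a • ψ + b • φ) :=
  (hψ.smul a).add (hφ.smul b)

/-- `ins φ (O + O') = ins φ O + ins φ O'` for physical `φ, O, O'`. [folklore] -/
theorem ins_add {φ O O' : GaugeConfig 3 L SU2 → ℝ} (hφ : IsPhys φ) (hO : IsPhys O) (hO' : IsPhys O') :
    OpPlat.ins φ (O + O') = OpPlat.ins φ O + OpPlat.ins φ O' := by
  rw [OpPlat.ins_eq, OpPlat.ins_eq, OpPlat.ins_eq, add_mul]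
  have h : l2 φ (O * φ + O' * φ) = l2 φ (O * φ) + l2 φ (O' * φ) := by
    rw [l2_comm, l2_add_left (OpPlat.isPhys_mul hO hφ) (OpPlat.isPhys_mul hO' hφ) hφ, l2_comm (O * φ), l2_comm (O' * φ)]
  rw [h, add_smul]
  abel

/-- `ins φ (c•O) = c • ins φ O`. [folklore] -/
theorem ins_smul (φ O : GaugeConfig 3 L SU2 → ℝ) (c : ℝ) : OpPlat.ins φ (c • O) = c • OpPlat.ins φ O := by
  rw [OpPlat.ins_eq, OpPlat.ins_eq]
  have h1 : (c • O) * φ = c • (O * φ) := by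
    funext U
    simp only [Pi.mul_apply, Pi.smul_apply, smul_eq_mul, mul_assoc]
  have h2 : l2 φ (c • (O * φ)) = c * l2 φ (O * φ) := by rw [l2_comm, l2_smul_left, l2_comm]
  rw [h1, h2, smul_sub, smul_smul]

/-- `flowLiftAt` is additive in the one-site function. [folklore] -/
theorem flowLiftAt_add (x₀ : Site 3 L) (t : ℝ) (g h : Cfg → ℝ) : flowLiftAt (L := L) x₀ t (g + h) = flowLiftAt x₀ t g + flowLiftAt x₀ t h := rfl

/-- `flowLiftAt` is homogeneous in the one-site function. [folklore] -/
theorem flowLiftAt_smul (x₀ : Site 3 L) (t : ℝ) (c : ℝ) (g : Cfg → ℝ) : flowLiftAt (L := L) x₀ t (c • g) = c • flowLiftAt x₀ t g := rfl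

/-- `liftVec β φ (g + h) = liftVec β φ g + liftVec β φ h` for physical `φ, g, h`. [cite: LuscherWolff1990] -/
theorem liftVec_add (β : ℝ) {φ : GaugeConfig 3 L SU2 → ℝ} (hφ : IsPhys φ) {g h : Cfg → ℝ} (hg : IsPhys g) (hh : IsPhys h) :
    liftVec β φ (g + h) = liftVec β φ g + liftVec β φ h := by
  show OpPlat.ins φ (flowLiftAt (L := L) 0 (flowTime β L) (g + h)) = _
  rw [flowLiftAt_add, ins_add hφ (isPhys_flowLiftAt 0 _ hg) (isPhys_flowLiftAt 0 _ hh)]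

/-- `liftVec β φ (c•g) = c • liftVec β φ g`. [cite: LuscherWolff1990] -/
theorem liftVec_smul (β : ℝ) (φ : GaugeConfig 3 L SU2 → ℝ) (c : ℝ) (g : Cfg → ℝ) : liftVec β φ (c • g) = c • liftVec β φ g := by
  show OpPlat.ins φ (flowLiftAt (L := L) 0 (flowTime β L) (c • g)) = _
  rw [flowLiftAt_smul, ins_smul]

/-- `K_β^n (ψ + φ) = K_β^n ψ + K_β^n φ` for physical `ψ, φ`. [folklore] -/
theorem iterate_transferApply_add (β : ℝ) {ψ φ : GaugeConfig 3 L SU2 → ℝ} (hψ : IsPhys ψ) (hφ : IsPhys φ) (n : ℕ) :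
    (transferApply (L := L) β)^[n] (ψ + φ) = (transferApply β)^[n] ψ + (transferApply β)^[n] φ := by
  induction n with
  | zero => rfl
  | succ n ih =>
    rw [Function.iterate_succ_apply', Function.iterate_succ_apply', Function.iterate_succ_apply', ih,
      transferApply_add β (isPhys_iterate_transferApply β hψ n) (isPhys_iterate_transferApply β hφ n)]

/-- `K_β^n (c•ψ) = c • K_β^n ψ`. [folklore] -/
theorem iterate_transferApply_smul (β c : ℝ) (ψ : GaugeConfig 3 L SU2 → ℝ) (n : ℕ) :
    (transferApply (L := L) β)^[n] (c • ψ) = c • (transferApply β)^[n] ψ := by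
  induction n with
  | zero => rfl
  | succ n ih => rw [Function.iterate_succ_apply', Function.iterate_succ_apply', ih, transferApply_smul]

/-- ★ `dressedLiftVec β φ (g + h) = dressedLiftVec β φ g + dressedLiftVec β φ h` for physical `φ, g, h`. [cite: LuscherWolff1990] -/
theorem dressedLiftVec_add (β : ℝ) {φ : GaugeConfig 3 L SU2 → ℝ} (hφ : IsPhys φ) {g h : Cfg → ℝ} (hg : IsPhys g) (hh : IsPhys h) :
    dressedLiftVec β φ (g + h) = dressedLiftVec β φ g + dressedLiftVec β φ h := by
  unfold dressedLiftVec
  rw [liftVec_add β hφ hg hh, iterate_transferApply_add β (isPhys_liftVec β hφ hg) (isPhys_liftVec β hφ hh)]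

/-- ★ `dressedLiftVec β φ (c•g) = c • dressedLiftVec β φ g`. [cite: LuscherWolff1990] -/
theorem dressedLiftVec_smul (β : ℝ) (φ : GaugeConfig 3 L SU2 → ℝ) (c : ℝ) (g : Cfg → ℝ) :
    dressedLiftVec β φ (c • g) = c • dressedLiftVec β φ g := by
  unfold dressedLiftVec
  rw [liftVec_smul, iterate_transferApply_smul]

/-! ## §2 Expansion of `‖a u + b v‖²` -/

/-- `⟨a u + b v, a u + b v⟩ = a²⟨u,u⟩ + 2ab⟨u,v⟩ + b²⟨v,v⟩` for physical `u, v`. [folklore] -/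
theorem l2_self_add_smul {M : ℕ} [NeZero M] {u v : GaugeConfig 3 M SU2 → ℝ} (hu : IsPhys u) (hv : IsPhys v) (a b : ℝ) :
    l2 (a • u + b • v) (a • u + b • v) = a ^ 2 * l2 u u + 2 * (a * b) * l2 u v + b ^ 2 * l2 v v := by
  have hau : IsPhys (a • u) := hu.smul a
  have hbv : IsPhys (b • v) := hv.smul b
  have hs : IsPhys (a • u + b • v) := hau.add hbv
  rw [l2_add_left hau hbv hs, l2_comm (a • u), l2_comm (b • v), l2_add_left hau hbv hau, l2_add_left hau hbv hbv,
    OpPlat.l2_smul_smul, OpPlat.l2_smul_smul, OpPlat.l2_smul_smul, OpPlat.l2_smul_smul, l2_comm v u]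
  ring

/-! ## §3 ★★ Polarisation: the Gram certificate from a near-isometry on two-channel planes -/

/-- ★★ **Near-isometry on the plane of two channels ⟹ near-orthogonality.**  If for all real `a, b`
`(1−ε)(a²n_i + b²n_l) ≤ ‖dressedLiftVec β φ (a•g_i + b•g_l)‖² ≤ (1+ε)(a²n_i + b²n_l)` (`n_i, n_l > 0`; `φ, g_i, g_l` physical), then
`|⟨u_i, u_l⟩| ≤ ε·√n_i·√n_l` for `u = dressedLiftVec β φ g`. [cite: Luscher1983, §3] [cite: LuscherWolff1990] -/
theorem gram_offDiag_le_of_nearIsometry (β : ℝ) {φ : GaugeConfig 3 L SU2 → ℝ} (hφ : IsPhys φ) {gi gl : Cfg → ℝ} (hgi : IsPhys gi) (hgl : IsPhys gl)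
    {ni nl ε : ℝ} (hni : 0 < ni) (hnl : 0 < nl)
    (hiso : ∀ a b : ℝ,
      (1 - ε) * (a ^ 2 * ni + b ^ 2 * nl) ≤ l2 (dressedLiftVec β φ (a • gi + b • gl)) (dressedLiftVec β φ (a • gi + b • gl)) ∧
        l2 (dressedLiftVec β φ (a • gi + b • gl)) (dressedLiftVec β φ (a • gi + b • gl)) ≤ (1 + ε) * (a ^ 2 * ni + b ^ 2 * nl)) :
    |l2 (dressedLiftVec β φ gi) (dressedLiftVec β φ gl)| ≤ ε * (Real.sqrt ni * Real.sqrt nl) := by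
  set u := dressedLiftVec β φ gi with hu
  set v := dressedLiftVec β φ gl with hv
  have huP : IsPhys u := isPhys_dressedLiftVec β hφ hgi
  have hvP : IsPhys v := isPhys_dressedLiftVec β hφ hgl
  set a : ℝ := 1 / Real.sqrt ni with ha
  set b : ℝ := 1 / Real.sqrt nl with hb
  have hsi : 0 < Real.sqrt ni := Real.sqrt_pos.mpr hni
  have hsl : 0 < Real.sqrt nl := Real.sqrt_pos.mpr hnl
  have ha2 : a ^ 2 * ni = 1 := by rw [ha, div_pow, one_pow, Real.sq_sqrt hni.le, one_div, inv_mul_cancel₀ hni.ne']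
  have hb2 : b ^ 2 * nl = 1 := by rw [hb, div_pow, one_pow, Real.sq_sqrt hnl.le, one_div, inv_mul_cancel₀ hnl.ne']
  have hnb2 : (-b) ^ 2 * nl = 1 := by rw [neg_sq, hb2]
  -- the two test vectors `a u ± b v`
  have hlin : ∀ s : ℝ, dressedLiftVec β φ (a • gi + s • gl) = a • u + s • v := fun s => by
    rw [dressedLiftVec_add β hφ (hgi.smul a) (hgl.smul s), dressedLiftVec_smul, dressedLiftVec_smul]
  have hplus := hiso a b
  have hminus := hiso a (-b)
  rw [hlin b, l2_self_add_smul huP hvP, ha2, hb2] at hplus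
  rw [hlin (-b), l2_self_add_smul huP hvP, ha2, hnb2] at hminus
  -- `4ab⟨u,v⟩ ∈ [−4ε, 4ε]`
  have hab : 0 < a * b := by rw [ha, hb]; positivity
  have hkey : |a * b * l2 u v| ≤ ε := by
    rw [abs_le]
    constructor
    · nlinarith [hplus.1, hminus.2]
    · nlinarith [hplus.2, hminus.1]
  have hprod : a * b * (Real.sqrt ni * Real.sqrt nl) = 1 := by
    rw [ha, hb]
    field_simp
  calc |l2 u v| = |a * b * l2 u v| * (Real.sqrt ni * Real.sqrt nl) := by
          rw [abs_mul, abs_of_pos hab, mul_comm (a * b) |l2 u v|, mul_assoc, hprod, mul_one]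
    _ ≤ ε * (Real.sqrt ni * Real.sqrt nl) := mul_le_mul_of_nonneg_right hkey (by positivity)

/-- ★★ **Both static clauses from a near-isometry on every two-channel plane**, symmetric pairs exempt: `φ` a raw vacuum, `g_i` physical, flat weights
`n_i > 0` with `(1−ε)n_i ≤ ‖u_i‖²`; for each pair `i ≠ l` either `PairSeparated (g i) (g l)` or the plane near-isometry of `gram_offDiag_le_of_nearIsometry`;
`0 ≤ ε < 1`, `0 ≤ C`, `ε/(1−ε) ≤ C·λ` ⟹ `StaticClauses k C β (dressedLiftFamily β φ g)`. [cite: Luscher1983, §3] [cite: LuscherWolff1990] -/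
theorem staticClauses_of_nearIsometry (β : ℝ) {φ : GaugeConfig 3 L SU2 → ℝ} (hvac : IsRawVacuum β φ) {k : ℕ} {g : Fin k → (Cfg → ℝ)}
    (hg : ∀ i, IsPhys (g i)) (n : Fin k → ℝ) (hn : ∀ i, 0 < n i) {ε : ℝ} (hε0 : 0 ≤ ε) (hε1 : ε < 1)
    (hdiag : ∀ i, (1 - ε) * n i ≤ l2 (dressedLiftFamily β φ g i) (dressedLiftFamily β φ g i))
    (hplane : ∀ i l : Fin k, i ≠ l → PairSeparated (g i) (g l) ∨ ∀ a b : ℝ,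
      (1 - ε) * (a ^ 2 * n i + b ^ 2 * n l) ≤ l2 (dressedLiftVec β φ (a • g i + b • g l)) (dressedLiftVec β φ (a • g i + b • g l)) ∧
        l2 (dressedLiftVec β φ (a • g i + b • g l)) (dressedLiftVec β φ (a • g i + b • g l)) ≤ (1 + ε) * (a ^ 2 * n i + b ^ 2 * n l))
    {C : ℝ} (hC0 : 0 ≤ C) (hC : ε / (1 - ε) ≤ C * luscherLambda β L) :
    StaticClauses k C β (dressedLiftFamily β φ g) := by
  refine staticClauses_of_gramClose_or_separated β hvac hg (fun i => Real.sqrt (n i)) (fun i => Real.sqrt_pos.mpr (hn i)) hε0 hε1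
    (fun i => by rw [Real.sq_sqrt (hn i).le]; exact hdiag i) (fun i l hil => ?_) hC0 hC
  rcases hplane i l hil with hsep | hiso
  · exact Or.inl hsep
  · exact Or.inr (gram_offDiag_le_of_nearIsometry β hvac.1 (hg i) (hg l) (hn i) (hn l) hiso)

end Summit.QuantumFields.YangMills.Theorems.FemtoTransferGap.PolyakovLift

end
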